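import Literature.NumberTheory.LFunctions.ClassGroupUnsmoothing
import Literature.NumberTheory.LFunctions.UniformClassGroupPNT
import HarnessLib

/-!
# Unsmoothing a SIGNED character sum with trivial short-interval bounds

Topic `Summits/QuantumAdvantage/QuantumAdvantage/Theorems`, helper for the stub
`stub_perCharacterDeficit_of_density` (line `subgroup-orthogonality-escape`, crux
`DegreeOnePrimesEscape`, stmt-QuantumAdvantage-11543).

For a class group character `χ` of a number field `K`, `t > 1`, `ε > 0` and the Thorner–Zaman
weight `g_t = tzTest (log t) ε` the signed Chebyshev sum `T(t) = Σ_C Re χ(C) θ_C(t)` and the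
smoothed character sum `Re K_χ(g_t) = Re Σ_n Λ_χ(n) g_t(log n) = Σ_C Re χ(C) ψ̃_C(g_t)`
(`re_coefFordK_cgCoef_eq_sum`) differ by at most

  `ψ_K(√t) + (ψ_K(t e^ε) − ψ_K(t)) + (ψ_K(t) − θ_K(t))`

(`abs_thetaChar_sub_re_coefFordK_le`; class by class `θ_C ≤ ψ_C ≤ ψ̃_C(g_t) + ψ_C(√t)` and
`ψ̃_C(g_t) ≤ ψ_C(te^ε)`, summed with `|Re χ(C)| ≤ 1`), and this is at most
`n_K (log t + 1)(8√t + 2εt + 1)` for `0 < ε ≤ 1` (`unsmoothing_error_le`,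
`thetaChar_le_re_coefFordK_add`): TRIVIAL
bounds for the prime powers in `(t, te^ε]`, no Brun–Titchmarsh.
-/

noncomputable section

open Complex Real Finset
open scoped NumberField nonZeroDivisors
open Literature.NumberTheory.LFunctions Literature.NumberTheory.LFunctions.NumberField
  Literature.NumberTheory.LFunctions.TZWeight

namespace Summit.QuantumAdvantage.QuantumAdvantage.Theorems.DegreeOnePrimesEscape

variable {K : Type} [Field K] [NumberField K]

/-! ### The smoothed character sum through the smoothed class sums -/

/-- `K_{g,Λ_χ}(0) = Σ_n Λ_χ(n) g(log n) = Σ_C χ(C) ψ̃_C(g)` for `g` vanishing on `[x₀, ∞)`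
(`Λ_χ = Σ_C χ(C) Λ_C`). -/
theorem coefFordK_cgCoef_eq_sum (χ : ClassGroup (𝓞 K) →* ℂˣ) {g : ℝ → ℝ} {x₀ : ℝ}
    (hg : ∀ u, x₀ ≤ u → g u = 0) :
    coefFordK (cgCoef χ) g 0 = ∑ C, (χ C : ℂ) * (smoothedPsiClass K C g : ℂ) := by
  classical
  obtain ⟨N, hN⟩ : ∃ N : ℕ, x₀ ≤ Real.log N ∧ 1 ≤ N := by
    obtain ⟨N, hN⟩ := exists_nat_gt (Real.exp x₀)
    have hN0 : (0 : ℝ) < N := (Real.exp_pos _).trans hN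
    refine ⟨N, ?_, ?_⟩
    · rw [Real.le_log_iff_exp_le hN0]; exact hN.le
    · exact_mod_cast Nat.one_le_iff_ne_zero.2 (by rintro rfl; simp at hN0)
  rw [coefFordK_eq_sum _ hg hN.2 hN.1]
  simp_rw [smoothedPsiClass_eq_sum _ hg hN.2 hN.1, neg_zero, Complex.cpow_zero, mul_one,
    cgCoef_eq_sum_vonMangoldtClass, Finset.sum_mul, Complex.ofReal_sum, Complex.ofReal_mul,
    Finset.mul_sum]
  rw [Finset.sum_comm]
  refine Finset.sum_congr rfl fun C _ ↦ Finset.sum_congr rfl fun n _ ↦ by ring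

/-- `Re K_{g,Λ_χ}(0) = Σ_C Re χ(C) · ψ̃_C(g)`. -/
theorem re_coefFordK_cgCoef_eq_sum (χ : ClassGroup (𝓞 K) →* ℂˣ) {g : ℝ → ℝ} {x₀ : ℝ}
    (hg : ∀ u, x₀ ≤ u → g u = 0) :
    (coefFordK (cgCoef χ) g 0).re = ∑ C, (χ C : ℂ).re * smoothedPsiClass K C g := by
  rw [coefFordK_cgCoef_eq_sum χ hg, Complex.re_sum]
  exact Finset.sum_congr rfl fun C _ ↦ Complex.re_mul_ofReal _ _

/-! ### The signed comparison -/

/-- `|Re χ(C)| ≤ 1`. -/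
theorem abs_re_classGroupChar_le (χ : ClassGroup (𝓞 K) →* ℂˣ) (C : ClassGroup (𝓞 K)) :
    |(χ C : ℂ).re| ≤ 1 := by
  have := Complex.abs_re_le_norm (χ C : ℂ)
  rwa [norm_classGroupChar_apply χ C] at this

/-- `|p − q| ≤ U + V` when `p − q ≤ U` and `q − p ≤ V`. -/
theorem abs_sub_le_add_of_le {p q U V : ℝ} (h1 : p - q ≤ U) (h2 : q - p ≤ V) (hU : 0 ≤ U)
    (hV : 0 ≤ V) : |p - q| ≤ U + V := by
  rw [abs_le]; constructor <;> linarith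

/-- **Signed unsmoothing.** For every class group character `χ`, `t > 1`, `ε > 0`:
`|Σ_C Re χ(C) θ_C(t) − Re K_χ(g_t)| ≤ ψ_K(√t) + (ψ_K(te^ε) − ψ_K(t)) + (ψ_K(t) − θ_K(t))`,
`g_t = tzTest (log t) ε`. -/
theorem abs_thetaChar_sub_re_coefFordK_le (χ : ClassGroup (𝓞 K) →* ℂˣ) {t ε : ℝ} (ht : 1 < t)
    (hε : 0 < ε) :
    |∑ C, (χ C : ℂ).re * chebyshevThetaIdealClass K C t -
        (coefFordK (cgCoef χ) (tzTest (Real.log t) ε) 0).re| ≤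
      chebyshevPsiIdeal K (Real.sqrt t) + (chebyshevPsiIdeal K (t * Real.exp ε) - chebyshevPsiIdeal K t) +
        (chebyshevPsiIdeal K t - chebyshevThetaIdeal K t) := by
  have hL : 0 < Real.log t := Real.log_pos ht
  set g := tzTest (Real.log t) ε with hg
  have hg0 : ∀ u, Real.log t + ε ≤ u → g u = 0 := fun u hu ↦ tzTest_eq_zero_of_ge hL hε hu
  rw [re_coefFordK_cgCoef_eq_sum χ hg0, ← Finset.sum_sub_distrib]
  -- class by class
  have hC : ∀ C : ClassGroup (𝓞 K),
      |(χ C : ℂ).re * chebyshevThetaIdealClass K C t - (χ C : ℂ).re * smoothedPsiClass K C g| ≤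
        classPsi K C (Real.sqrt t) + (classPsi K C (t * Real.exp ε) - classPsi K C t) +
          (classPsi K C t - chebyshevThetaIdealClass K C t) := by
    intro C
    rw [← mul_sub, abs_mul]
    have h1 := chebyshevThetaIdealClass_le_classPsi (K := K) C t
    have h2 := classPsi_le_smoothedPsiClass_add (K := K) C ht hε
    have h3 := smoothedPsiClass_le_classPsi (K := K) C ht hε
    have h4 : classPsi K C t ≤ classPsi K C (t * Real.exp ε) :=
      classPsi_mono C (by have := Real.one_le_exp hε.le; nlinarith)
    have hkey : |chebyshevThetaIdealClass K C t - smoothedPsiClass K C g| ≤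
        classPsi K C (Real.sqrt t) + (classPsi K C (t * Real.exp ε) - classPsi K C t) +
          (classPsi K C t - chebyshevThetaIdealClass K C t) := by
      rw [add_assoc]
      refine abs_sub_le_add_of_le (by rw [hg]; linarith) (by rw [hg]; linarith)
        (classPsi_nonneg C _) (by linarith)
    calc |(χ C : ℂ).re| * |chebyshevThetaIdealClass K C t - smoothedPsiClass K C g|
        ≤ 1 * |chebyshevThetaIdealClass K C t - smoothedPsiClass K C g| :=
          mul_le_mul_of_nonneg_right (abs_re_classGroupChar_le χ C) (abs_nonneg _)
      _ ≤ _ := by rw [one_mul]; exact hkey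
  refine (Finset.abs_sum_le_sum_abs _ _).trans ((Finset.sum_le_sum fun C _ ↦ hC C).trans ?_)
  rw [Finset.sum_add_distrib, Finset.sum_add_distrib, Finset.sum_sub_distrib, Finset.sum_sub_distrib,
    sum_classPsi, sum_classPsi, sum_classPsi, sum_chebyshevThetaIdealClass K t]

/-! ### Trivial bounds for the three error terms -/

/-- **Prime powers in a short interval, trivially**: `ψ_K(y) − ψ_K(t) ≤ n_K (y − t + 1) log y` for
`1 ≤ t ≤ y` (`Λ_K(m) ≤ n_K Λ(m) ≤ n_K log m ≤ n_K log y` for the `≤ y − t + 1` integers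
`m ∈ (t, y]`). -/
theorem chebyshevPsiIdeal_sub_le {t y : ℝ} (ht : 1 ≤ t) (hty : t ≤ y) :
    chebyshevPsiIdeal K y - chebyshevPsiIdeal K t ≤ Module.finrank ℚ K * ((y - t + 1) * Real.log y) := by
  have hy0 : 0 ≤ y := by linarith
  have hsub : Icc 0 ⌊t⌋₊ ⊆ Icc 0 ⌊y⌋₊ := Icc_subset_Icc le_rfl (Nat.floor_le_floor hty)
  rw [chebyshevPsiIdeal, chebyshevPsiIdeal, ← Finset.sum_sdiff hsub, add_sub_cancel_right]
  have hdiff : Icc 0 ⌊y⌋₊ \ Icc 0 ⌊t⌋₊ = Finset.Ioc ⌊t⌋₊ ⌊y⌋₊ := by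
    ext m; simp only [Finset.mem_sdiff, Finset.mem_Icc, Finset.mem_Ioc]; omega
  rw [hdiff]
  have hterm : ∀ m ∈ Finset.Ioc ⌊t⌋₊ ⌊y⌋₊, vonMangoldtIdeal K m ≤ Module.finrank ℚ K * Real.log y := by
    intro m hm
    rw [Finset.mem_Ioc] at hm
    have hm0 : 0 < m := by omega
    have hmy : (m : ℝ) ≤ y := (Nat.cast_le.2 hm.2).trans (Nat.floor_le hy0)
    refine (vonMangoldtIdeal_le_finrank_mul_vonMangoldt K m).trans ?_
    refine mul_le_mul_of_nonneg_left ?_ (Nat.cast_nonneg _)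
    exact ArithmeticFunction.vonMangoldt_le_log.trans (Real.log_le_log (by exact_mod_cast hm0) hmy)
  refine (Finset.sum_le_sum hterm).trans ?_
  rw [Finset.sum_const, nsmul_eq_mul, Nat.card_Ioc]
  have hcard : ((⌊y⌋₊ - ⌊t⌋₊ : ℕ) : ℝ) ≤ y - t + 1 := by
    have h1 : (⌊y⌋₊ : ℝ) ≤ y := Nat.floor_le hy0
    have h2 : t < (⌊t⌋₊ : ℝ) + 1 := Nat.lt_floor_add_one t
    have h3 : ⌊t⌋₊ ≤ ⌊y⌋₊ := Nat.floor_le_floor hty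
    rw [Nat.cast_sub h3]; linarith
  have hlogy : 0 ≤ Real.log y := Real.log_nonneg (by linarith)
  have hn : (0 : ℝ) ≤ Module.finrank ℚ K := Nat.cast_nonneg _
  calc ((⌊y⌋₊ - ⌊t⌋₊ : ℕ) : ℝ) * (Module.finrank ℚ K * Real.log y)
      = Module.finrank ℚ K * (((⌊y⌋₊ - ⌊t⌋₊ : ℕ) : ℝ) * Real.log y) := by ring
    _ ≤ Module.finrank ℚ K * ((y - t + 1) * Real.log y) :=
        mul_le_mul_of_nonneg_left (mul_le_mul_of_nonneg_right hcard hlogy) hn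

/-- `ψ_K(√t) ≤ n_K (log 4 + 4) √t`. -/
theorem chebyshevPsiIdeal_sqrt_le (t : ℝ) :
    chebyshevPsiIdeal K (Real.sqrt t) ≤ Module.finrank ℚ K * ((Real.log 4 + 4) * Real.sqrt t) :=
  (chebyshevPsiIdeal_le_finrank_mul_psi K _).trans
    (mul_le_mul_of_nonneg_left (Chebyshev.psi_le_const_mul_self (Real.sqrt_nonneg t)) (Nat.cast_nonneg _))

/-- **The unsmoothing error, explicitly**: for `t > 1` and `0 < ε ≤ 1`,
`ψ_K(√t) + (ψ_K(te^ε) − ψ_K(t)) + (ψ_K(t) − θ_K(t)) ≤ n_K (log t + 1)(8√t + 2εt + 1)`. -/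
theorem unsmoothing_error_le {t ε : ℝ} (ht : 1 < t) (hε : 0 < ε) (hε1 : ε ≤ 1) :
    chebyshevPsiIdeal K (Real.sqrt t) + (chebyshevPsiIdeal K (t * Real.exp ε) - chebyshevPsiIdeal K t) +
        (chebyshevPsiIdeal K t - chebyshevThetaIdeal K t) ≤
      Module.finrank ℚ K * ((Real.log t + 1) * (8 * Real.sqrt t + 2 * ε * t + 1)) := by
  have ht0 : 0 < t := by linarith
  have ht1 : 1 ≤ t := ht.le
  set n : ℝ := (Module.finrank ℚ K : ℝ) with hn
  have hn0 : 0 ≤ n := Nat.cast_nonneg _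
  have hlogt : 0 < Real.log t := Real.log_pos ht
  have hsqrt0 : 0 ≤ Real.sqrt t := Real.sqrt_nonneg t
  -- (1) `ψ_K(√t)`
  have h1 : chebyshevPsiIdeal K (Real.sqrt t) ≤ n * (6 * Real.sqrt t) := by
    refine (chebyshevPsiIdeal_sqrt_le t).trans (mul_le_mul_of_nonneg_left ?_ hn0)
    have hlog4 : Real.log 4 < 2 := by
      have : Real.log 4 = 2 * Real.log 2 := by
        rw [show (4:ℝ) = 2 ^ 2 by norm_num, Real.log_pow]; norm_num
      rw [this]; have := Real.log_two_lt_d9; linarith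
    nlinarith
  -- (2) the short interval `(t, te^ε]`
  have hexp : t ≤ t * Real.exp ε := by have := Real.one_le_exp hε.le; nlinarith
  have h2 : chebyshevPsiIdeal K (t * Real.exp ε) - chebyshevPsiIdeal K t ≤
      n * ((2 * ε * t + 1) * (Real.log t + 1)) := by
    refine (chebyshevPsiIdeal_sub_le ht1 hexp).trans (mul_le_mul_of_nonneg_left ?_ hn0)
    have he1 : Real.exp ε - 1 ≤ 2 * ε := by
      have := Real.abs_exp_sub_one_le (x := ε) (by rw [abs_of_pos hε]; exact hε1)
      rw [abs_of_pos hε] at this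
      exact (le_abs_self _).trans this
    have hgap : t * Real.exp ε - t + 1 ≤ 2 * ε * t + 1 := by nlinarith
    have hlog : Real.log (t * Real.exp ε) ≤ Real.log t + 1 := by
      rw [Real.log_mul ht0.ne' (Real.exp_pos ε).ne', Real.log_exp]; linarith
    have hlog0 : 0 ≤ Real.log (t * Real.exp ε) := Real.log_nonneg (by nlinarith [Real.one_le_exp hε.le])
    have hgap0 : 0 ≤ t * Real.exp ε - t + 1 := by linarith
    exact mul_le_mul hgap hlog hlog0 (by positivity)
  -- (3) the prime powers
  have h3 : chebyshevPsiIdeal K t - chebyshevThetaIdeal K t ≤ n * (2 * Real.sqrt t * Real.log t) := by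
    refine (chebyshevPsiIdeal_sub_chebyshevThetaIdeal_le K ht1).trans ?_
    have h := primeIdealCount_le_two_mul_finrank_mul K hsqrt0
    rw [← hn] at h
    calc (primeIdealCount K (Real.sqrt t) : ℝ) * Real.log t ≤ (2 * n * Real.sqrt t) * Real.log t :=
          mul_le_mul_of_nonneg_right h hlogt.le
      _ = n * (2 * Real.sqrt t * Real.log t) := by ring
  have hsum : n * (6 * Real.sqrt t) + n * ((2 * ε * t + 1) * (Real.log t + 1)) +
      n * (2 * Real.sqrt t * Real.log t) ≤ n * ((Real.log t + 1) * (8 * Real.sqrt t + 2 * ε * t + 1)) := by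
    have hin : 6 * Real.sqrt t + (2 * ε * t + 1) * (Real.log t + 1) + 2 * Real.sqrt t * Real.log t ≤
        (Real.log t + 1) * (8 * Real.sqrt t + 2 * ε * t + 1) := by
      nlinarith [mul_nonneg hsqrt0 hlogt.le]
    have := mul_le_mul_of_nonneg_left hin hn0
    linarith
  linarith

/-- **Signed unsmoothing, explicit form**: for every character `χ`, `t > 1`, `0 < ε ≤ 1`,
`Σ_C Re χ(C) θ_C(t) ≤ Re K_χ(g_t) + n_K (log t + 1)(8√t + 2εt + 1)`. -/
theorem thetaChar_le_re_coefFordK_add (χ : ClassGroup (𝓞 K) →* ℂˣ) {t ε : ℝ} (ht : 1 < t)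
    (hε : 0 < ε) (hε1 : ε ≤ 1) :
    ∑ C, (χ C : ℂ).re * chebyshevThetaIdealClass K C t ≤
      (coefFordK (cgCoef χ) (tzTest (Real.log t) ε) 0).re +
        Module.finrank ℚ K * ((Real.log t + 1) * (8 * Real.sqrt t + 2 * ε * t + 1)) := by
  have h1 := abs_thetaChar_sub_re_coefFordK_le (K := K) χ ht hε
  have h2 := unsmoothing_error_le (K := K) ht hε hε1
  have h3 := (abs_le.1 (h1.trans h2)).2
  linarith

/-- Closed form of `thetaChar_le_re_coefFordK_add`: the registered sub-goal of the stub `stub_perCharacterDeficit_of_density`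
proved by this file. -/
theorem perCharacterDeficit_unsmoothing : ∀ {K : Type} [Field K] [NumberField K] (χ : ClassGroup (𝓞 K) →* ℂˣ) {t ε : ℝ} (ht : 1 < t)
    (hε : 0 < ε) (hε1 : ε ≤ 1),
    ∑ C, (χ C : ℂ).re * chebyshevThetaIdealClass K C t ≤
      (coefFordK (cgCoef χ) (tzTest (Real.log t) ε) 0).re +
        Module.finrank ℚ K * ((Real.log t + 1) * (8 * Real.sqrt t + 2 * ε * t + 1)) :=
  @thetaChar_le_re_coefFordK_add

end Summit.QuantumAdvantage.QuantumAdvantage.Theorems.DegreeOnePrimesEscape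

end
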